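import Summits.QuantumFields.BalabanUV.T4Continuum.Support.PerturbationAlgebra

/-!
# T⁴ programme, spine node NE2 (U1a) — COVARIANT OUTER AVERAGING AS A PAIRING DEFECT: block averages with UNIMODULAR TRANSPORT
# FACTORS `Q_L·diag(u)`, `|u| ≤ 1`, `|u − 1| ≤ γ·L^{−k}`, fit `FreeTowerLaws` with `F = √(L^d)·Q_L(diag u − 1)J`, `‖F𝒢‖ ≤ γ·Cst·L^{−k}`;
# hence the perturbed η-rate with BOTH a background perturbation of `Δ_a` AND background-dependent averaging (model)

Ninth generation of the NE2 prover lineage P1 of the cell `pub-balaban`, file 11.  In [Balaban1985BackgroundPropagators] (3.18)–(3.19)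
the averaging itself depends on the background: `(Q(U)A)(y) = Σ_{x ∈ B(y)} L^{−d} U(Γ_{y,x})·A(x)·…`, parallel transport along the block
contours.  For an ABELIAN background the transport is a unimodular FACTOR per fine site, `Q(U) = Q_L·diag(u)`, `|u(x)| = 1`, and in a
global small gauge `|u(x) − 1| ≤ (contour length)·(bond size) = O(α·L^{−k})`.  Such averagings are exactly covered by the pairing-defect
slot `F` of `Spine/BackgroundResolventLaw.perturbed_sandwich_law` / `FreeTowerLaws`:

 * §1 `UnimodularTransport u γ` (data class: `|u_k| ≤ 1`, `|u_k − 1| ≤ γ/L^k`), `Acov u k := Q_L·diag(u_k)` (`‖Acov‖² ≤ L^{−d}`),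
   `Fcov u k := √(L^d)·Q_L(diag u_k − 1)J_k`, the pairing `√(L^d)·Acov·J = 1 + Fcov`, `‖Fcov·𝒢‖, ‖𝒢·Fcovᴴ‖ ≤ γ·Cst·L^{−k}` (NO derivative is
   spent: the transport defect is already `O(L^{−k})` in sup norm);
 * §2 **`freeTowerLaws_covariant`**, **`towerLimitRate_perturbed_covariant`** (every `PerturbationLaws` family, `‖t‖κ < 1`; constant
   `Cpert κ (2dCst) CJ C₂ (γCst) t`) and **`towerLimitRate_covariantMinimalCoupling`** (files 7–8's model perturbation together with the
   transported averaging) — the closest MODEL of [B9]'s structure (covariant averaging ∘ covariant propagator) reachable without the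
   covariant carriers.

HONEST FRAMING (T4-DAG p. 1).  Abelian-type scalar transport factors (no colour matrices), global small gauge, the transport family `u`
is DATA with typed smallness (not derived from a connection here); finite torus, linear layer, operator norm; rates / pairing /
constants OURS; nothing printed is a hypothesis; NOT infinite volume / mass gap / Clay / summit progress; spine 0/9 unchanged.  HONEST
DEPENDENCY: continuum YM on T⁴ ⇐ BetaPertH ∧ nine spine estimates (0/9 proved); BetaPertH ⇐ (D1) ∧ (D4) ∧ CAP+tail; G-an2-4 gates
asym, D1 and NE2/3/4.  ABSOLUTE RULE kept; no `sorry`.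
-/

noncomputable section

open scoped BigOperators ComplexConjugate Matrix Matrix.Norms.L2Operator
open Filter Topology

namespace Summit.QuantumFields.BalabanUV.T4Continuum.CovariantAveragingModel

open Literature.MathematicalPhysics.QuantumFieldTheory.Balaban1983to89.B5Prop11Plancherel
open Literature.MathematicalPhysics.QuantumFieldTheory.Balaban1983to89.B5G183RateTorusW
open Literature.MathematicalPhysics.QuantumFieldTheory.Balaban1983to89.B5G183RateUnitTower (lev lev_neZero)
open Summit.QuantumFields.BalabanUV.T4Continuum
open Summit.QuantumFields.BalabanUV.T4Continuum.CovariantAveragingTower (TowerLimitRate)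
open Summit.QuantumFields.BalabanUV.T4Continuum.BalabanAveragedTowerUnit (idx Qlev calGlev one_le_lev' cast_lev' opNorm_Qlev_sq_le)
open Summit.QuantumFields.BalabanUV.T4Continuum.BackgroundResolventTower
open Summit.QuantumFields.BalabanUV.T4Continuum.KingPairingPlantedLaw
open Summit.QuantumFields.BalabanUV.T4Continuum.BlockPairingGeometry
open Summit.QuantumFields.BalabanUV.T4Continuum.NE2PerturbedLayer
open Summit.QuantumFields.BalabanUV.T4Continuum.FirstOrderBackgroundModel
open Summit.QuantumFields.BalabanUV.T4Continuum.PerturbationAlgebra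

variable {d : ℕ} (L : ℕ) [NeZero L] (M : Fin d → ℕ) [hM : ∀ μ, NeZero (M μ)]

/-! ## §1 Transported block averagings and their pairing defect -/

/-- **UNIMODULAR TRANSPORT FACTORS** along the tower: `u_k` on the sites of level `k+1` (the factor `U(Γ_{y,x})` attached to the
fine site `x` of the block of `y`), with `|u_k| ≤ 1` and `|u_k − 1| ≤ γ/L^k` (contour length × bond size in a global small gauge).
A hypothesis on DATA. [folklore] -/
structure UnimodularTransport (u : (k : ℕ) → (idx L M (k + 1) → ℂ)) (γ : ℝ) : Prop where
  /-- `γ ≥ 0` -/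
  nonneg : 0 ≤ γ
  /-- contraction -/
  le_one : ∀ k i, ‖u k i‖ ≤ 1
  /-- closeness to the trivial transport -/
  sub_one : ∀ k i, ‖u k i - 1‖ ≤ γ / (lev L k : ℕ)

/-- the TRANSPORTED one-step averaging `Q_L·diag(u_k)` (abelian `Q(U)` of [B9] (3.18)–(3.19), model).
[cite: Balaban1985BackgroundPropagators, (3.18)-(3.19) p.393 (shape)] [folklore] -/
def Acov (u : (k : ℕ) → (idx L M (k + 1) → ℂ)) (k : ℕ) : Matrix (idx L M k) (idx L M (k + 1)) ℂ :=
  Qlev L M k * Matrix.diagonal (u k)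

/-- its pairing defect against King's pairing: `F_k = √(L^d)·Q_L(diag u_k − 1)J_k`. [folklore] -/
def Fcov (u : (k : ℕ) → (idx L M (k + 1) → ℂ)) (k : ℕ) : Matrix (idx L M k) (idx L M k) ℂ :=
  ((((Real.sqrt ((L : ℝ) ^ d)) : ℝ) : ℂ)) • (Qlev L M k * (Matrix.diagonal (u k) - 1) * JpcT L M k)

/-- `‖Q_L·diag(u)‖² ≤ L^{−d}` for a contraction `u`. [folklore] -/
theorem opNorm_Acov_sq_le {u : (k : ℕ) → (idx L M (k + 1) → ℂ)} {γ : ℝ} (hu : UnimodularTransport L M u γ) (k : ℕ) :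
    ‖Acov L M u k‖ ^ 2 ≤ (((L : ℝ) ^ d))⁻¹ := by
  have h1 : ‖Acov L M u k‖ ≤ ‖Qlev L M k‖ :=
    (Matrix.l2_opNorm_mul _ _).trans ((mul_le_mul_of_nonneg_left (opNorm_diagonal_le _ zero_le_one (hu.le_one k))
      (norm_nonneg _)).trans (le_of_eq (mul_one _)))
  exact (pow_le_pow_left₀ (norm_nonneg _) h1 2).trans (opNorm_Qlev_sq_le L M k)

/-- the pairing identity `√(L^d)·Q_L·diag(u_k)·J_k = 1 + F_k`. [folklore] -/
theorem sqrt_smul_Acov_mul_JpcT (u : (k : ℕ) → (idx L M (k + 1) → ℂ)) (k : ℕ) :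
    ((((Real.sqrt ((L : ℝ) ^ d)) : ℝ) : ℂ)) • (Acov L M u k * JpcT L M k) = 1 + Fcov L M u k := by
  have h0 := sqrt_smul_Qlev_mul_JpcT L M k
  rw [add_zero] at h0
  rw [Fcov, Acov, ← h0, ← smul_add]
  congr 1
  rw [Matrix.mul_sub, Matrix.sub_mul, Matrix.mul_one, Matrix.mul_assoc]
  abel

variable (a : ℝ) (ha : 0 < a)

/-- `‖F_k·𝒢^{(k)}‖ ≤ γ·Cst·L^{−k}` — no derivative spent. [cite: Balaban1984PropagatorsI, Prop. 1.1 (1.89) p.33] [folklore] -/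
theorem opNorm_Fcov_mul_calG_le {u : (k : ℕ) → (idx L M (k + 1) → ℂ)} {γ : ℝ} (hu : UnimodularTransport L M u γ) (k : ℕ) :
    ‖Fcov L M u k * (calDalev L M a ha k)⁻¹‖ ≤ γ * Cst d a * ((L : ℝ)⁻¹) ^ k := by
  have hLd : (0 : ℝ) < (L : ℝ) ^ d := pow_pos (by exact_mod_cast Nat.pos_of_ne_zero (NeZero.ne L)) d
  have hs0 : 0 < Real.sqrt ((L : ℝ) ^ d) := Real.sqrt_pos.mpr hLd
  have hlev : (0 : ℝ) < (lev L k : ℕ) := by exact_mod_cast one_le_lev' L k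
  have hC := Cst_nonneg d a
  have hD : ‖Matrix.diagonal (u k) - 1‖ ≤ γ / (lev L k : ℕ) := by
    rw [← Matrix.diagonal_one, Matrix.diagonal_sub]
    exact opNorm_diagonal_le _ (div_nonneg hu.nonneg hlev.le) fun i => hu.sub_one k i
  have hγ' : 0 ≤ γ / (lev L k : ℕ) := div_nonneg hu.nonneg hlev.le
  rw [Fcov, Matrix.smul_mul, norm_smul, Complex.norm_real, Real.norm_of_nonneg hs0.le, calDalev_inv]
  calc Real.sqrt ((L : ℝ) ^ d) * ‖Qlev L M k * (Matrix.diagonal (u k) - 1) * JpcT L M k * calGlev L M a ha k‖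
      ≤ Real.sqrt ((L : ℝ) ^ d) * ((Real.sqrt ((L : ℝ) ^ d))⁻¹ * (γ / (lev L k : ℕ)) * 1 * Cst d a) := by
        refine mul_le_mul_of_nonneg_left ?_ hs0.le
        calc _ ≤ ‖Qlev L M k * (Matrix.diagonal (u k) - 1) * JpcT L M k‖ * ‖calGlev L M a ha k‖ := Matrix.l2_opNorm_mul _ _
          _ ≤ (‖Qlev L M k * (Matrix.diagonal (u k) - 1)‖ * ‖JpcT L M k‖) * ‖calGlev L M a ha k‖ :=
              mul_le_mul_of_nonneg_right (Matrix.l2_opNorm_mul _ _) (norm_nonneg _)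
          _ ≤ ((Real.sqrt ((L : ℝ) ^ d))⁻¹ * (γ / (lev L k : ℕ)) * 1) * Cst d a := by
              refine mul_le_mul (mul_le_mul ((Matrix.l2_opNorm_mul _ _).trans (mul_le_mul (opNorm_Qavg_le (lev L k) L M) hD
                (norm_nonneg _) (by positivity))) (opNorm_JpcT_le L M k) (norm_nonneg _) (by positivity))
                (opNorm_calG_le _ (one_le_lev' L k) M a ha) (norm_nonneg _) (by positivity)
    _ = γ * Cst d a * ((L : ℝ)⁻¹) ^ k := by rw [cast_lev', inv_pow]; field_simp

/-- `‖𝒢^{(k)}·F_kᴴ‖ ≤ γ·Cst·L^{−k}` (`𝒢` Hermitian). [folklore] -/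
theorem opNorm_calG_mul_Fcov_conjTranspose_le {u : (k : ℕ) → (idx L M (k + 1) → ℂ)} {γ : ℝ} (hu : UnimodularTransport L M u γ)
    (k : ℕ) : ‖(calDalev L M a ha k)⁻¹ * (Fcov L M u k)ᴴ‖ ≤ γ * Cst d a * ((L : ℝ)⁻¹) ^ k := by
  have e : (calDalev L M a ha k)⁻¹ * (Fcov L M u k)ᴴ = (Fcov L M u k * (calDalev L M a ha k)⁻¹)ᴴ := by
    have hH : (calGlev L M a ha k)ᴴ = calGlev L M a ha k := (calG_isHermitian (lev L k) (one_le_lev' L k) M a ha).eq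
    rw [Matrix.conjTranspose_mul, calDalev_inv, hH]
  rw [e, Matrix.l2_opNorm_conjTranspose]
  exact opNorm_Fcov_mul_calG_le L M a ha hu k

/-! ## §2 The perturbed tower with transported averaging -/

/-- **`FreeTowerLaws` FOR TRANSPORTED AVERAGINGS — A THEOREM** for every `UnimodularTransport u γ`: pairing defects `γCst·L^{−k}`,
complement / injected defects of file 3. [folklore] -/
theorem freeTowerLaws_covariant {u : (k : ℕ) → (idx L M (k + 1) → ℂ)} {γ : ℝ} (hu : UnimodularTransport L M u γ) :
    FreeTowerLaws (calDalev L M a ha) (Acov L M u) (JpcT L M) (Fcov L M u) ((L : ℝ) ^ d)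
      (fun k => 2 * d * Cst d a * ((L : ℝ)⁻¹) ^ k) (fun k => CJ d a * ((L : ℝ)⁻¹) ^ k) (fun k => γ * Cst d a * ((L : ℝ)⁻¹) ^ k) where
  isUnit_det := isUnit_det_calDalev L M a ha
  opNorm_A_sq_le := opNorm_Acov_sq_le L M hu
  opNorm_J_le := opNorm_JpcT_le L M
  A_mul_J := sqrt_smul_Acov_mul_JpcT L M u
  opNorm_F_mul_inv_le := opNorm_Fcov_mul_calG_le L M a ha hu
  opNorm_inv_mul_F_le := opNorm_calG_mul_Fcov_conjTranspose_le L M a ha hu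
  complement_le := complement_le_lev L M a ha
  injected_le := injected_le_lev L M a ha

/-- **THE PERTURBED η-RATE WITH TRANSPORTED AVERAGING** (`L ≥ 2`): for every `UnimodularTransport u γ`, every `PerturbationLaws`
family (`κ`, `C₂L^{−k}`) and every `‖t‖κ < 1`, the unit-lattice covariances `(L^d)^k·A^{(k)}(u)(Δ_a^{(k)} + tP_k)⁻¹A^{(k)}(u)ᴴ`
CONVERGE with rate `L^{−k}`, constant `Cpert κ (2dCst) CJ C₂ (γCst) t`. [cite: King1986, Lemma 4.5 (4.32)/(4.38) p.674;
Balaban1985BackgroundPropagators, (3.18)-(3.19) p.393, (3.23)-(3.24) p.394 (shapes)] [folklore] -/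
theorem towerLimitRate_perturbed_covariant (hL : 2 ≤ L) {u : (k : ℕ) → (idx L M (k + 1) → ℂ)} {γ : ℝ}
    (hu : UnimodularTransport L M u γ) {P : (k : ℕ) → Matrix (idx L M k) (idx L M k) ℂ} {κ C₂ : ℝ}
    (hpert : PerturbationLaws (calDalev L M a ha) P (JpcT L M) κ (fun k => C₂ * ((L : ℝ)⁻¹) ^ k)) {t : ℂ} (ht : ‖t‖ * κ < 1) :
    TowerLimitRate (Acov L M u) ((L : ℝ) ^ d) (fun k => (calDalev L M a ha k + t • P k)⁻¹)
      (Cpert κ (2 * d * Cst d a) (CJ d a) C₂ (γ * Cst d a) t) ((L : ℝ)⁻¹) := by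
  have hL1 : (1 : ℝ) < L := by exact_mod_cast (lt_of_lt_of_le one_lt_two hL : 1 < L)
  have hr : (0 : ℝ) < (L : ℝ) ^ d := pow_pos (lt_trans zero_lt_one hL1) d
  exact towerLimitRate_perturbed hr (freeTowerLaws_covariant L M a ha hu) hpert (inv_lt_one_of_one_lt₀ hL1)
    (fun k => le_rfl) (fun k => le_rfl) (fun k => le_rfl) (fun k => le_rfl) ht

/-- **COVARIANT MINIMAL-COUPLING MODEL** (`L ≥ 2`, `d ≥ 1`): transported averaging (`u`, `γ`) ∘ `(Δ_a + t(Σ_μ𝒜_μ∇_μ + W))⁻¹`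
(Lipschitz `𝒜`: `α, β`; bounded consistent `W`: `α′, β′`), `‖t‖·((d(α + β) + α′)Cst) < 1` — η-rate `L^{−k}`, explicit constant, NO
typed residual. [folklore] -/
theorem towerLimitRate_covariantMinimalCoupling (hL : 2 ≤ L) (hd : 1 ≤ d) {u : (k : ℕ) → (idx L M (k + 1) → ℂ)} {γ : ℝ}
    (hu : UnimodularTransport L M u γ) {V : (k : ℕ) → Fin d → (idx L M k → ℂ)} {W : (k : ℕ) → (idx L M k → ℂ)}
    {α β α' β' : ℝ} (hV : LipschitzBackground L M V α β) (hW : BoundedBackground L M W α' β') {t : ℂ}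
    (ht : ‖t‖ * kappaMC d a α β α' < 1) :
    TowerLimitRate (Acov L M u) ((L : ℝ) ^ d) (fun k => (calDalev L M a ha k + t • Pmc L M V W k)⁻¹)
      (Cpert (kappaMC d a α β α') (2 * d * Cst d a) (CJ d a) (C2MC d L a α β β') (γ * Cst d a) t) ((L : ℝ)⁻¹) :=
  towerLimitRate_perturbed_covariant L M a ha hL hu (perturbationLaws_minimalCoupling L M a ha hd hV hW) ht

end Summit.QuantumFields.BalabanUV.T4Continuum.CovariantAveragingModel

end
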